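import Mathlib
import Summits.ValiantsHypothesis.ValiantsHypothesis.Theses.PermanentalCones
import Summits.ValiantsHypothesis.ValiantsHypothesis.Theorems.PermanentalConesPermanentalInVP

/-!
# Route `PermanentalCones` — assembly (item stmt-ValiantsHypothesis-8660)

`Assembly := PermanentalConeHard → HyperbolicVPShadow → ValiantsHypothesis`.

Bookkeeping over proved tree facts. Assume H+ (`PermanentalConeHard`: directions `r n`,
entrywise nonnegative constants `Y n` and the permanental family
`P n := per[(Y n)_{rows < r n}; s^{(n - r n)}]`, hyperbolic w.r.t. `𝟙`, whose closed hyperbolicity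
cones admit, for every `c`, some `n` with no lifted-LMI description of size `≤ 2^((log₂ n + c)^c)`)
and HT (`HyperbolicVPShadow`: every hyperbolic homogeneous real family whose complexification is a
`VP_ℂ` family has cones that are spectrahedral shadows of quasi-polynomial size). If
`VP ℂ = VNP ℂ` then `per ∈ VP_ℂ` (Valiant: `per ∈ VNP`, `perFamily_mem_VNP_holds`; renaming bridge
`mem_VP_ofFintype_iff_holds`), hence, by the route's proved support item `PermanentalInVP`
(`Theorems/PermanentalConesPermanentalInVP.lean`, `permanentalInVP_proof`: the complexified
permanental family is the Valiant projection of `PER_n` under `X_{ij} ↦ Y n i j` (`i < r n`) /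
`s_j` (else) with `t = id`, and a p-family), the complexified permanental family is a `VP_ℂ`
family. `P n` is homogeneous (of degree `#{j : r n ≤ j}`, `isHomogeneous_permanental`) and
hyperbolic w.r.t. `𝟙` in the form HT consumes, so HT at
`v = id, f = P, e = 𝟙` gives `c` and shadows of size `≤ 2^((log₂ n + c)^c)` for every `n`, while
H+ at this `c` gives an `n` with no such shadow — contradiction. (Same composition as the route's
deciding theorem `PermanentalCones.closes`, with its `PermanentalInVP` hypothesis discharged by
`permanentalInVP_proof`; the argument is inlined so that this file does not depend on the
planner-authored `closes`.)
Valiant 1979; Bürgisser 2000, §2.1, Rem. 2.7.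
-/

-- `Summit.ValiantsHypothesis.ValiantsHypothesis.…` is the tree's mandated single-conjunct layout
-- (Sub = Summit), so the duplicated namespace component is intended.
set_option linter.dupNamespace false

namespace Summit.ValiantsHypothesis.ValiantsHypothesis.Theorems.PermanentalCones

open Literature.Computability.AlgebraicComplexity
open Summit.ValiantsHypothesis.ValiantsHypothesis.Theses.PermanentalCones

/-- The permanental polynomial `per[Y_{rows < r}; s^{(n-r)}]` (rows `i < r` the constants `Y i j`,
the other rows the variable row `s`) is homogeneous of degree `#{j : ¬ j < r}`: every summand
`∏ᵢ M (σ i) i` of the permanent is a product of `#{i : σ i < r}` constants and `#{i : ¬ σ i < r}`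
variables, and `σ` is a bijection. [folklore] -/
theorem isHomogeneous_permanental (n r : ℕ) (Y : Matrix (Fin n) (Fin n) ℝ) :
    (Matrix.of fun i j : Fin n =>
        if (i : ℕ) < r then MvPolynomial.C (Y i j) else MvPolynomial.X j).permanent.IsHomogeneous
      (∑ j : Fin n, (if (j : ℕ) < r then 0 else 1)) := by
  unfold Matrix.permanent
  refine MvPolynomial.IsHomogeneous.sum _ _ _ (fun σ _ => ?_)
  have hprod := MvPolynomial.IsHomogeneous.prod (Finset.univ : Finset (Fin n))
    (fun i => (Matrix.of fun i j : Fin n =>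
      if (i : ℕ) < r then MvPolynomial.C (Y i j) else MvPolynomial.X j) (σ i) i)
    (fun i => if ((σ i : Fin n) : ℕ) < r then 0 else 1) (fun i _ => ?_)
  · rwa [Equiv.sum_comp σ (fun j : Fin n => if (j : ℕ) < r then (0 : ℕ) else 1)] at hprod
  · simp only [Matrix.of_apply]
    split_ifs
    · exact MvPolynomial.isHomogeneous_C _ _
    · exact MvPolynomial.isHomogeneous_X _ _

/-- **Settles item stmt-ValiantsHypothesis-8660** (assembly of route `PermanentalCones`):
`PermanentalConeHard → HyperbolicVPShadow → ValiantsHypothesis`. If `VP ℂ = VNP ℂ` then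
`per ∈ VP_ℂ` (`perFamily_mem_VNP_holds`, `mem_VP_ofFintype_iff_holds`), so the H+ witness family
is a `VP_ℂ` family (`permanentalInVP_proof`), homogeneous (`isHomogeneous_permanental`) and
hyperbolic w.r.t. `𝟙`; HT gives `c` with quasi-polynomial shadows for all `n`, H+ at this `c` an
`n` with none. [folklore] -/
theorem assembly_proof :
    Summit.ValiantsHypothesis.ValiantsHypothesis.Theses.PermanentalCones.Assembly := by
  unfold Summit.ValiantsHypothesis.ValiantsHypothesis.Theses.PermanentalCones.Assembly
  intro h_PermanentalConeHard h_HyperbolicVPShadow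
  show Literature.Computability.AlgebraicComplexity.VP ℂ ≠
    Literature.Computability.AlgebraicComplexity.VNP ℂ
  intro hEq
  -- VP = VNP puts the permanent family in VP (Valiant: PER ∈ VNP; bundling bridge).
  have hVNP := Literature.Computability.AlgebraicComplexity.perFamily_mem_VNP_holds ℂ
  have hVP : Literature.Computability.AlgebraicComplexity.perFamily ℂ ∈
      Literature.Computability.AlgebraicComplexity.VP ℂ := by
    rw [hEq]; exact hVNP
  have hper : Literature.Computability.AlgebraicComplexity.IsVPFamily
      (fun n => Literature.Computability.AlgebraicComplexity.perPoly (Fin n) ℂ) :=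
    (Literature.Computability.AlgebraicComplexity.mem_VP_ofFintype_iff_holds _).1 hVP
  -- The H+ witnesses: directions r, nonnegative constants Y, permanental family P.
  obtain ⟨r, Y, _hY, hH⟩ := h_PermanentalConeHard
  let P : ∀ n : ℕ, MvPolynomial (Fin n) ℝ := fun n =>
    (Matrix.of fun i j : Fin n =>
      if (i : ℕ) < r n then MvPolynomial.C (Y n i j) else MvPolynomial.X j).permanent
  obtain ⟨hhyp, hnone⟩ := hH P (fun n => rfl)
  -- Projection closure (`permanentalInVP_proof`): per ∈ VP ⇒ the permanental family is in VP.
  have hfam : Literature.Computability.AlgebraicComplexity.IsVPFamily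
      (fun n => MvPolynomial.map (algebraMap ℝ ℂ) (P n)) := permanentalInVP_proof hper r Y
  -- Homogeneity: every summand of the permanent has degree #{j : r n ≤ j}.
  have hhom : ∀ n, ∃ d : ℕ, (P n).IsHomogeneous d :=
    fun n => ⟨_, isHomogeneous_permanental n (r n) (Y n)⟩
  -- Hyperbolicity w.r.t. 𝟙 in the form HT consumes (z * 1 = z).
  have hhyp' : ∀ n, MvPolynomial.eval ((fun (n : ℕ) (_ : Fin n) => (1 : ℝ)) n) (P n) ≠ 0 ∧
      ∀ (x : Fin n → ℝ) (z : ℂ), MvPolynomial.eval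
        (fun j => (x j : ℂ) + z * (((fun (n : ℕ) (_ : Fin n) => (1 : ℝ)) n j : ℝ) : ℂ))
          (MvPolynomial.map (algebraMap ℝ ℂ) (P n)) = 0 → z.im = 0 := by
    intro n
    refine ⟨(hhyp n).1, fun x z hz => (hhyp n).2 x z ?_⟩
    simpa using hz
  -- HT at v = id, f = P, e = 𝟙: qp-size shadows for every n …
  obtain ⟨c, hc⟩ := h_HyperbolicVPShadow (fun n => n) P (fun n _ => 1) hfam hhom hhyp'
  -- … while H+ at this c gives an n with no such shadow: contradiction.
  obtain ⟨n, hn⟩ := hnone c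
  obtain ⟨m, hm, p, A, B, hrep⟩ := hc n
  refine hn m hm p A B (fun x => Iff.trans (forall_congr' fun τ => ?_) (hrep x))
  have e1 : (fun j : Fin n => x j + τ) = x + τ • (fun _ : Fin n => (1 : ℝ)) := by
    funext j; simp
  rw [e1]

end Summit.ValiantsHypothesis.ValiantsHypothesis.Theorems.PermanentalCones
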